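import Summits.AtomisticToContinuum.FouriersLaw.Theses.EmbeddedDrudeMourre
import Literature.MathematicalPhysics.KineticTheory.ZeroWavenumberSpace
import Summits.AtomisticToContinuum.FouriersLaw.Theorems.EmbeddedDrudeMourreMourreDissolutionFrameworkReduction
import Summits.AtomisticToContinuum.FouriersLaw.Theorems.EmbeddedDrudeMourreDrudeDissolutionStubPencilFrameworkDatum
import Summits.AtomisticToContinuum.FouriersLaw.Theorems.EmbeddedDrudeMourreDrudeDissolutionStubRichFrameworkClustering

/-!
# Stub F `stub_richFramework` of line `kinetic-polymer-gas-on-the-time-axis`, crux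
`EmbeddedDrudeMourre.DrudeDissolution` (stmt-AtomisticToContinuum-12593; `--supports` file, closes nothing)

**The RICH zero-wavenumber framework over the Buttà–Marchioro dynamics.** For
`pinnedChain ω₂ lam β γ` (all four `> 0`) and every `T ∈ (0, 1)` (indeed every `T > 0`): the
canonical symmetric Buttà–Marchioro dynamics `D` (`D.carrier = bmGood`, commuting everywhere with
the translations) and Doyon data `Z : ZeroWavenumberData (pinnedChain …) D` whose state is a DLR
Gibbs state at `T`, momentum-reversal symmetric, with strongly continuous Koopman group,
`ι`-symmetric (`ι σ = σ(−·)` preserves `Z.μ`, the carrier and `𝒱`), and whose observable space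
`𝒱 = Z.localObs` contains all coordinates `q_x, p_x` AND IS CLOSED UNDER PRODUCTS:
`𝒱 = Algebra.adjoin ℝ {u ∘ φ_s : u ∈ 𝒫, s ∈ ℝ}` = the span of the multi-time monomials
`Π_i (u_i ∘ φ_{s_i})` of the local polynomials `𝒫 = Algebra.adjoin ℝ {q_x, p_x}`.

Assembly (`richFramework_datum`, `stub_richFramework`) of: F-a `pencilFramework_dynamics` of the
sibling line (the dynamics and its exact `τ`/`R`/`ι` covariance, general `γ`); part R-C
`richFramework_clustering` (the transfer-operator Gibbs state with summable space–time clustering and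
continuity at `0` for all multi-time monomials — built on R-M `richFramework_monomials`, the weighted
`L¹`-locality of multi-time monomials, and R-T `richFramework_transfer`, the two-sided clustering
transfer); the span/strong-continuity generators lemmas of the tree
(`integrable_count_cov_of_span`, `isStronglyContinuous_of_generators`, Følner positivity
`integral_count_covariance_comp_shift_nonneg`); `Algebra.adjoin_eq_span` for the product closure.
-/

noncomputable section

open MeasureTheory ProbabilityTheory Set Filter Topology Function Real
open scoped InnerProductSpace ENNReal BigOperators
open Literature.MathematicalPhysics.KineticTheory
open Literature.MathematicalPhysics.KineticTheory.HeatConduction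
open Literature.MathematicalPhysics.KineticTheory.PhononBoltzmann
open Summit.AtomisticToContinuum.FouriersLaw.Theorems.DrudeDissolution.GramPencilHarmonicChaos

namespace Summit.AtomisticToContinuum.FouriersLaw.Theorems.DrudeDissolution.KineticPolymerGasOnTheTimeAxis

variable {P : OscillatorChain}

/-- **Precomposition stability of the monoid of multi-time monomials**: if every generator
`u ∘ φ_s` composed with `g` lies in the monoid, so does every element composed with `g`
(precomposition is a monoid homomorphism). [folklore] -/
theorem comp_mem_closure_of_forall (D : InfiniteChainDynamics P) (g : ChainConfig → ChainConfig)
    (hg : ∀ u ∈ Algebra.adjoin ℝ (Set.range fun xc : ℤ × Bool => fun σ : ChainConfig => if xc.2 then (σ xc.1).2 else (σ xc.1).1), ∀ s : ℝ, (u ∘ D.flow s) ∘ g ∈ Submonoid.closure {w : (ℤ → ℝ × ℝ) → ℝ |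
      ∃ u ∈ Algebra.adjoin ℝ (Set.range fun xc : ℤ × Bool => fun σ : ChainConfig => if xc.2 then (σ xc.1).2 else (σ xc.1).1), ∃ s : ℝ, w = u ∘ D.flow s})
    {M : ChainConfig → ℝ}
    (hM : M ∈ Submonoid.closure {w : (ℤ → ℝ × ℝ) → ℝ | ∃ u ∈ Algebra.adjoin ℝ (Set.range fun xc : ℤ × Bool => fun σ : ChainConfig => if xc.2 then (σ xc.1).2 else (σ xc.1).1), ∃ s : ℝ, w = u ∘ D.flow s}) :
    M ∘ g ∈ Submonoid.closure {w : (ℤ → ℝ × ℝ) → ℝ | ∃ u ∈ Algebra.adjoin ℝ (Set.range fun xc : ℤ × Bool => fun σ : ChainConfig => if xc.2 then (σ xc.1).2 else (σ xc.1).1), ∃ s : ℝ, w = u ∘ D.flow s} := by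
  induction hM using Submonoid.closure_induction with
  | mem o ho =>
    obtain ⟨u, hu, s, rfl⟩ := ho
    exact hg u hu s
  | one => exact Submonoid.one_mem _
  | mul M₁ M₂ _ _ ih₁ ih₂ => exact Submonoid.mul_mem _ ih₁ ih₂

/-- **The rich symmetric zero-wavenumber datum from the multi-time-monomial clustering inputs.**
Inputs: a dynamics `D` of `pinnedChain ω₂ lam β γ` with `φ_0 = id`, exact group law and exact
`τ`/`R`/`ι` covariance; a `D`-invariant, shift-invariant, `R`-invariant probability measure `μ` in
which every multi-time monomial `M` (element of the monoid generated by `{u ∘ φ_s : u ∈ 𝒫}`) is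
square integrable, with `Σ_x |Cov_μ(M, M' ∘ τ_x)| < ∞` for all pairs and continuity at `0` of
`t ↦ Σ_x Cov_μ(M, (M ∘ τ_x) ∘ φ_t)`. Output: a `ZeroWavenumberData (pinnedChain ω₂ lam β γ) D` with
state `μ`, momentum-reversal symmetric, with strongly continuous Koopman group, `ι`-stable
observables `𝒱 = span(monoid) = Algebra.adjoin ℝ {u ∘ φ_s}` containing the coordinates and closed
under products. [cite: Doyon2022, §4.1 Def. 4.3–4.4 and §4.3 Thm 4.11] -/
theorem richFramework_datum {ω₂ lam β γ : ℝ} (D : InfiniteChainDynamics (pinnedChain ω₂ lam β γ))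
    (h0 : D.flow 0 = id) (hgrp : ∀ t s : ℝ, D.flow (t + s) = D.flow t ∘ D.flow s)
    (hsh : ∀ (t : ℝ) (x : ℤ), D.flow t ∘ chainShift x = chainShift x ∘ D.flow t)
    (hrev : ∀ t : ℝ, chainReversal ∘ D.flow t = D.flow (-t) ∘ chainReversal)
    (hrefl : ∀ t : ℝ, (fun (σ : ℤ → ℝ × ℝ) (y : ℤ) => σ (-y)) ∘ D.flow t =
      D.flow t ∘ fun (σ : ℤ → ℝ × ℝ) (y : ℤ) => σ (-y))
    (μ : Measure ChainConfig) [IsProbabilityMeasure μ] (hpres : D.PreservesMeasure μ)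
    (hT : ∀ x : ℤ, MeasurePreserving (chainShift x) μ μ) (hRμ : MeasurePreserving chainReversal μ μ)
    (hmem : ∀ M ∈ Submonoid.closure {w : (ℤ → ℝ × ℝ) → ℝ | ∃ u ∈ Algebra.adjoin ℝ (Set.range fun xc : ℤ × Bool => fun σ : ChainConfig => if xc.2 then (σ xc.1).2 else (σ xc.1).1), ∃ s : ℝ, w = u ∘ D.flow s},
      MemLp M 2 μ)
    (hsum : ∀ M ∈ Submonoid.closure {w : (ℤ → ℝ × ℝ) → ℝ | ∃ u ∈ Algebra.adjoin ℝ (Set.range fun xc : ℤ × Bool => fun σ : ChainConfig => if xc.2 then (σ xc.1).2 else (σ xc.1).1), ∃ s : ℝ, w = u ∘ D.flow s},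
      ∀ M' ∈ Submonoid.closure {w : (ℤ → ℝ × ℝ) → ℝ | ∃ u ∈ Algebra.adjoin ℝ (Set.range fun xc : ℤ × Bool => fun σ : ChainConfig => if xc.2 then (σ xc.1).2 else (σ xc.1).1), ∃ s : ℝ, w = u ∘ D.flow s},
      Summable fun x : ℤ => |cov[M, M' ∘ chainShift x; μ]|)
    (hcont : ∀ M ∈ Submonoid.closure {w : (ℤ → ℝ × ℝ) → ℝ | ∃ u ∈ Algebra.adjoin ℝ (Set.range fun xc : ℤ × Bool => fun σ : ChainConfig => if xc.2 then (σ xc.1).2 else (σ xc.1).1), ∃ s : ℝ, w = u ∘ D.flow s},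
      ContinuousAt (fun t : ℝ => ∑' x : ℤ, cov[M, (M ∘ chainShift x) ∘ D.flow t; μ]) 0) :
    ∃ Z : ZeroWavenumberData (pinnedChain ω₂ lam β γ) D, Z.μ = μ ∧ Z.HasMomentumReversal ∧
      Z.toFluctuationDynamics.IsStronglyContinuous ∧
      (∀ a ∈ Z.localObs, (a ∘ fun (σ : ChainConfig) (i : ℤ) => σ (-i)) ∈ Z.localObs) ∧
      (∀ x : ℤ, (fun σ : ChainConfig => (σ x).1) ∈ Z.localObs) ∧
      (∀ x : ℤ, (fun σ : ChainConfig => (σ x).2) ∈ Z.localObs) ∧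
      (∀ a ∈ Z.localObs, ∀ b ∈ Z.localObs, a * b ∈ Z.localObs) := by
  -- adapted from `GramPencilHarmonicChaos.pencilFramework_datum` (orbit ↦ monoid generated by the orbit)
  classical
  set O : Set (ChainConfig → ℝ) := {w : (ℤ → ℝ × ℝ) → ℝ | ∃ u ∈ Algebra.adjoin ℝ (Set.range fun xc : ℤ × Bool => fun σ : ChainConfig => if xc.2 then (σ xc.1).2 else (σ xc.1).1), ∃ s : ℝ, w = u ∘ D.flow s}
    with hO
  set S : Set (ChainConfig → ℝ) := ↑(Submonoid.closure O) with hSdef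
  set V : Submodule ℝ (ChainConfig → ℝ) := Submodule.span ℝ S with hVdef
  have hflow : ∀ t, MeasurePreserving (D.flow t) μ μ := hpres.2
  have hGS : ∀ u ∈ Algebra.adjoin ℝ (Set.range fun xc : ℤ × Bool => fun σ : ChainConfig => if xc.2 then (σ xc.1).2 else (σ xc.1).1), u ∈ S := fun u hu =>
    Submonoid.subset_closure ⟨u, hu, 0, by rw [h0, Function.comp_id]⟩
  have hgenS : ∀ u ∈ Algebra.adjoin ℝ (Set.range fun xc : ℤ × Bool => fun σ : ChainConfig => if xc.2 then (σ xc.1).2 else (σ xc.1).1), ∀ s : ℝ, u ∘ D.flow s ∈ S := fun u hu s =>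
    Submonoid.subset_closure ⟨u, hu, s, rfl⟩
  -- `V` is the subalgebra generated by the orbit: closed under products
  have hVA : ∀ a : ChainConfig → ℝ, a ∈ V ↔ a ∈ Algebra.adjoin ℝ O := fun a => by
    rw [← Subalgebra.mem_toSubmodule, Algebra.adjoin_eq_span]
  have hVmul : ∀ a ∈ V, ∀ b ∈ V, a * b ∈ V := fun a ha b hb =>
    (hVA _).2 (Subalgebra.mul_mem _ ((hVA a).1 ha) ((hVA b).1 hb))
  -- square integrability on `S` and on the span
  have hVmem : ∀ ⦃v : ChainConfig → ℝ⦄, v ∈ V → MemLp v 2 μ := by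
    intro v hv
    induction hv using Submodule.span_induction with
    | mem b hb => exact hmem b hb
    | zero => exact MemLp.zero
    | add b b' _ _ hb hb' => exact hb.add hb'
    | smul c b _ hb => exact hb.const_smul c
  -- stability of `S` (hence of `V`) under translations, the flow, `R` and `ι`
  have hS_shift : ∀ (y : ℤ) ⦃b : ChainConfig → ℝ⦄, b ∈ S → b ∘ chainShift y ∈ S := fun y b hb =>
    comp_chainShift_mem_closure D hsh y hb
  have hS_flow : ∀ (t : ℝ) ⦃b : ChainConfig → ℝ⦄, b ∈ S → b ∘ D.flow t ∈ S := fun t b hb => by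
    refine comp_mem_closure_of_forall D (D.flow t) (fun u hu s => ?_) hb
    have e : (u ∘ D.flow s) ∘ D.flow t = u ∘ D.flow (s + t) := by rw [hgrp s t]; rfl
    rw [e]
    exact hgenS u hu _
  have hS_R : ∀ ⦃b : ChainConfig → ℝ⦄, b ∈ S → b ∘ chainReversal ∈ S := fun b hb => by
    refine comp_mem_closure_of_forall D chainReversal (fun u hu s => ?_) hb
    have e : (u ∘ D.flow s) ∘ chainReversal = (u ∘ chainReversal) ∘ D.flow (-s) := by
      have h1 : D.flow s ∘ chainReversal = chainReversal ∘ D.flow (-s) := by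
        have := hrev (-s); rw [neg_neg] at this; exact this.symm
      rw [Function.comp_assoc, h1]
      rfl
    rw [e]
    exact hgenS _ (comp_chainReversal_mem_polyObs hu) _
  have hS_ι : ∀ ⦃b : ChainConfig → ℝ⦄, b ∈ S → (b ∘ fun (σ : ChainConfig) (i : ℤ) => σ (-i)) ∈ S :=
    fun b hb => by
    refine comp_mem_closure_of_forall D (fun (σ : ChainConfig) (i : ℤ) => σ (-i)) (fun u hu s => ?_) hb
    have e : ((u ∘ D.flow s) ∘ fun (σ : ChainConfig) (i : ℤ) => σ (-i)) =
        (u ∘ fun (σ : ChainConfig) (i : ℤ) => σ (-i)) ∘ D.flow s := by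
      rw [Function.comp_assoc, ← hrefl s]
      rfl
    rw [e]
    exact hgenS _ (comp_reflect_mem_polyObs hu) _
  have hV_shift : ∀ (y : ℤ) ⦃v : ChainConfig → ℝ⦄, v ∈ V → v ∘ chainShift y ∈ V := fun y v hv =>
    MourreDissolution.comp_mem_span_of_forall (chainShift y)
      (fun b hb => Submodule.subset_span (hS_shift y hb)) hv
  have hV_flow : ∀ (t : ℝ) ⦃v : ChainConfig → ℝ⦄, v ∈ V → v ∘ D.flow t ∈ V := fun t v hv =>
    MourreDissolution.comp_mem_span_of_forall (D.flow t)
      (fun b hb => Submodule.subset_span (hS_flow t hb)) hv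
  have hV_R : ∀ ⦃v : ChainConfig → ℝ⦄, v ∈ V → v ∘ chainReversal ∈ V := fun v hv =>
    MourreDissolution.comp_mem_span_of_forall chainReversal
      (fun b hb => Submodule.subset_span (hS_R hb)) hv
  have hV_ι : ∀ ⦃v : ChainConfig → ℝ⦄, v ∈ V → (v ∘ fun (σ : ChainConfig) (i : ℤ) => σ (-i)) ∈ V :=
    fun v hv => MourreDissolution.comp_mem_span_of_forall (fun (σ : ChainConfig) (i : ℤ) => σ (-i))
      (fun b hb => Submodule.subset_span (hS_ι hb)) hv
  -- summable clustering: generators, then the span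
  have hSS : ∀ b₁ ∈ S, ∀ b₂ ∈ S,
      Integrable (fun x : ℤ => cov[b₁, b₂ ∘ chainShift x; μ]) (Measure.count : Measure ℤ) := by
    intro b₁ hb₁ b₂ hb₂
    rw [integrable_count_iff]
    simpa only [Real.norm_eq_abs] using hsum b₁ hb₁ b₂ hb₂
  have hVint : ∀ ⦃v : ChainConfig → ℝ⦄, v ∈ V → ∀ ⦃w : ChainConfig → ℝ⦄, w ∈ V →
      Integrable (fun x : ℤ => cov[v, w ∘ chainShift x; μ]) (Measure.count : Measure ℤ) :=
    fun v hv w hw => integrable_count_cov_of_span chainShift hT (fun a ha => hVmem ha) hSS v hv w hw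
  -- the datum
  let Z : ZeroWavenumberData (pinnedChain ω₂ lam β γ) D :=
    { μ := μ
      isProbabilityMeasure := inferInstance
      measurePreserving_shift := hT
      localObs := V
      memLp_of_mem := hVmem
      comp_shift_mem := hV_shift
      integrable_cov := hVint
      form_self_nonneg := @fun a ha =>
        integral_count_covariance_comp_shift_nonneg chainShift hT (hVmem ha) (hVint ha ha)
      ae_mem_carrier := hpres.1
      measurePreserving_flow := hflow
      flow_comm_shift := fun t x => Eventually.of_forall fun σ => congrFun (hsh t x) σ
      comp_flow_mem := hV_flow
      bondCurrent_mem := Submodule.subset_span (hGS _ (bondCurrentZ_mem_polyObs ω₂ lam β γ))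
      energyDensity_mem := Submodule.subset_span (hGS _ (energyDensityZ_mem_polyObs ω₂ lam β γ)) }
  -- strong continuity from the generator autocorrelations
  have hsc : Z.toFluctuationDynamics.IsStronglyContinuous := by
    refine Z.toFluctuationDynamics.isStronglyContinuous_of_generators S
      (fun b hb => Submodule.subset_span hb) ?_ ?_
    · refine Submodule.span_le.2 ?_
      intro b hb
      refine Submodule.subset_span ⟨b, hb, 0, 0, ?_⟩
      funext σ
      simp only [comp_apply, ZeroWavenumberData.toFluctuationDynamics_flow, ShiftAction.apply_zero, h0, id_eq]
    · intro M hM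
      have hMV : M ∈ V := Submodule.subset_span hM
      have hform : (fun t : ℝ => Z.toFluctuationDynamics.form M (M ∘ Z.toFluctuationDynamics.flow t)) =
          fun t : ℝ => ∑' x : ℤ, cov[M, (M ∘ chainShift x) ∘ D.flow t; μ] := by
        funext t
        rw [ZeroWavenumberData.toFluctuationDynamics_flow]
        show Z.form M (M ∘ D.flow t) = _
        rw [Z.form_eq_tsum hMV (hV_flow t hMV)]
        refine tsum_congr fun x => ?_
        have e : (M ∘ D.flow t) ∘ chainShift x = (M ∘ chainShift x) ∘ D.flow t := by
          rw [Function.comp_assoc, hsh t x]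
          rfl
        rw [e]
      rw [hform]
      exact hcont M hM
  exact ⟨Z, rfl, ⟨hRμ, hV_R, fun t => Eventually.of_forall fun σ => congrFun (hrev t) σ⟩, hsc, hV_ι,
    fun x => Submodule.subset_span (hGS _ (position_mem_localPolynomials x)),
    fun x => Submodule.subset_span (hGS _ (momentum_mem_localPolynomials x)), hVmul⟩

/-- **STUB F of line `kinetic-polymer-gas-on-the-time-axis` — the rich zero-wavenumber framework**
(infrastructure; one proof serves the three lines of the crux). For `pinnedChain ω₂ lam β γ` (all
`> 0`) there is `T₀ > 0` (`T₀ = 1`; every `T > 0` works) such that for `T ∈ (0, T₀)` there are an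
infinite-volume dynamics `D` with `D.carrier = bmGood` whose flow commutes with the lattice
translations everywhere (the canonical symmetric Buttà–Marchioro dynamics), and Doyon data
`Z : ZeroWavenumberData (pinnedChain …) D` whose state is a DLR Gibbs state at `T` (the
transfer-operator Markov state), momentum-reversal symmetric, with strongly continuous Koopman group,
spatial-reflection symmetric (`ι` preserves `Z.μ`, the carrier and `𝒱`), and whose observable
space `𝒱 = Z.localObs` — the algebra generated by the flow-orbit of the local polynomials — contains
all coordinates `q_x, p_x` and is closed under products.
[cite: Doyon2022, §4.1 Def. 4.3–4.4, Thm 4.11] [cite: ButtaMarchioro2016, §2 Thm 2.1–2.2 and §3] -/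
theorem stub_richFramework : ∀ ω₂ lam β γ : ℝ, 0 < ω₂ → 0 < lam → 0 < β → 0 < γ → ∃ T₀ : ℝ, 0 < T₀ ∧ ∀ T : ℝ, 0 < T → T < T₀ → ∃ (D : InfiniteChainDynamics (pinnedChain ω₂ lam β γ)) (Z : ZeroWavenumberData (pinnedChain ω₂ lam β γ) D), D.carrier = (pinnedChain ω₂ lam β γ).bmGood ∧ (∀ (t : ℝ) (x : ℤ), D.flow t ∘ chainShift x = chainShift x ∘ D.flow t) ∧ (pinnedChain ω₂ lam β γ).IsChainGibbsMeasure T Z.μ ∧ Z.HasMomentumReversal ∧ Z.toFluctuationDynamics.IsStronglyContinuous ∧ MeasureTheory.MeasurePreserving (fun (σ : ChainConfig) (i : ℤ) => σ (-i)) Z.μ Z.μ ∧ Set.MapsTo (fun (σ : ChainConfig) (i : ℤ) => σ (-i)) D.carrier D.carrier ∧ (∀ a ∈ Z.localObs, (a ∘ fun (σ : ChainConfig) (i : ℤ) => σ (-i)) ∈ Z.localObs) ∧ (∀ x : ℤ, (fun σ : ChainConfig => (σ x).1) ∈ Z.localObs) ∧ (∀ x : ℤ, (fun σ : ChainConfig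 => (σ x).2) ∈ Z.localObs) ∧ (∀ a ∈ Z.localObs, ∀ b ∈ Z.localObs, a * b ∈ Z.localObs) := by
  intro ω₂ lam β γ hω hl hβ _hγ
  refine ⟨1, one_pos, fun T hT _ => ?_⟩
  -- the canonical symmetric Buttà–Marchioro dynamics (general `γ`)
  obtain ⟨D, hD, hm, hid, hgrp, -, hsh, hrev, hrefl⟩ :=
    pencilFramework_dynamics ω₂ lam β γ hω hl.le hβ.le
  have h0 : D.flow 0 = id := by
    funext σ
    by_cases hσ : σ ∈ (pinnedChain ω₂ lam β γ).bmGood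
    · exact D.flow_zero σ (by rw [hD]; exact hσ)
    · exact hid 0 σ hσ
  have hgrp' : ∀ t s : ℝ, D.flow (t + s) = D.flow t ∘ D.flow s := by
    intro t s
    funext σ
    by_cases hσ : σ ∈ (pinnedChain ω₂ lam β γ).bmGood
    · exact hgrp t s σ hσ
    · rw [comp_apply, hid (t + s) σ hσ, hid s σ hσ, hid t σ hσ]
  -- the clustering Gibbs state at temperature `T` (parts R-T, R-M, R-C)
  obtain ⟨μ, hG, hshift, hss, hιmap, hpres, hsum, hcont⟩ :=
    richFramework_clustering ω₂ lam β γ hω hl.le hβ.le T hT D hD hm hid hgrp' hsh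
  haveI := hG.isProbabilityMeasure
  have hmem : ∀ M ∈ Submonoid.closure {w : (ℤ → ℝ × ℝ) → ℝ | ∃ u ∈ Algebra.adjoin ℝ (Set.range fun xc : ℤ × Bool => fun σ : ChainConfig => if xc.2 then (σ xc.1).2 else (σ xc.1).1), ∃ s : ℝ, w = u ∘ D.flow s},
      MemLp M 2 μ := fun M hM => by
    obtain ⟨hMm, hMmom, -⟩ :=
      richFramework_monomials ω₂ lam β γ hω hl.le hβ.le T hT D hD hm hid hgrp' μ hG hshift hss M hM
    exact memLp_two_of_abs_sq hMm (hMmom 2)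
  -- the rich datum
  obtain ⟨Z, hZμ, hMR, hsc, hι, hq, hp, hmul⟩ :=
    richFramework_datum D h0 hgrp' hsh hrev hrefl μ hpres hshift.measurePreserving_chainShift
      (MourreDissolution.measurePreserving_chainReversal_of_isChainGibbsMeasure hG) hmem hsum hcont
  refine ⟨D, Z, hD, hsh, by rw [hZμ]; exact hG, hMR, hsc, ?_, ?_, hι, hq, hp, hmul⟩
  · rw [hZμ]
    exact ⟨MourreDissolution.measurable_reflect, hιmap⟩
  · rw [hD]
    exact MourreDissolution.mapsTo_reflect_bmGood _

end Summit.AtomisticToContinuum.FouriersLaw.Theorems.DrudeDissolution.KineticPolymerGasOnTheTimeAxis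

end
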